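import Literature.AlgebraicGeometry.HodgeTheory.HypersurfaceSectionComplementMorse
import HarnessLib

/-!
# The Euler characteristic of the smooth members of `|𝒪_X(d)|` tends to `-∞` (named fact), and
# BFNP 2009 Prop. 43 assembled from it

Family `hodge`, layer `Literature/AlgebraicGeometry/HodgeTheory`. Fact-decomposition record
(librarian, `fact-decompose`, 2026-08-16) for the named fact
`BFNP2009_vanishingCohomology_nontrivial` (`VanishingCohomologyNontrivial.lean`; P. Brosnan,
H. Fang, Z. Nie, G. Pearlstein, *Singularities of admissible normal functions*, Invent. Math. 177
(2009), §5 Prop. 43: for `𝓛 ≫ 0` the vanishing cycles of `|𝓛|` are non-trivial; in the tree: for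
`d ≫ 0` the restriction `H^{2n-1}(X(ℂ); ℂ) → H^{2n-1}(Y(ℂ); ℂ)` to a smooth hypersurface section
`Y = X ∩ V₊(F)`, `deg F = d`, of a smooth projective `2n`-fold `X` is not onto).

State of the printed proof in the tree. BFNP's proof is one sentence: "by taking `n ≫ 0`, and
considering Lefschetz pencils for the complete linear system `|𝓛ⁿ|`, we can make
`dim H^{2n-1}(𝒳_η)` tend to infinity" [cite: BrosnanFangNiePearlstein2009, §5 Prop. 43 (proof)].
The sibling proofs files formalise the folklore route behind that sentence:
`VanishingCohomologyNontrivialProofs` reduces the fact to (WL) weak Lefschetz below the middle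
degree and (EG) the decay of the topological Euler characteristic of the sections
(`…of_weakLefschetz_of_eulerChar`: Poincaré duality on `Y(ℂ)` and the arithmetic
`b_{2n-1}(Y) ≥ -χ_top(Y) - 2 Σ_{k<2n-1} b_k(X)`), and `HypersurfaceSectionComplementMorse` PROVES
(WL) through Andreotti–Frankel (Morse theory on the affine complement), leaving
`BFNP2009_vanishingCohomology_nontrivial.of_eulerChar`: **the fact follows from (EG) alone.**

This file NAMES (EG) — the one remaining input — as the fact `hypersurfaceSection_eulerChar_decay`
and records the assembly `BFNP2009_vanishingCohomology_nontrivial_holds_of`. (EG) is classical and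
independent of BFNP: for a smooth member `Y ∈ |𝒪_X(d)|` of the smooth projective `2n`-fold
`X ↪ ℙᴺ` (hyperplane class `H`, `deg X = H^{2n}[X] ≥ 1`), the Gauss–Bonnet–Chern theorem
`χ_top(Y(ℂ)) = ⟨c_{2n-1}(T_Y), [Y]⟩` and the adjunction formula `c(T_Y) = c(T_X)|_Y / (1 + dH|_Y)`
give `χ_top(Y(ℂ)) = Σ_{j=0}^{2n-1} (-1)^j d^{j+1} ⟨c_{2n-1-j}(T_X) H^{j+1}, [X]⟩
= -deg(X) · d^{2n} + O_X(d^{2n-1})`, which is `≤ -C` for `d ≥ d₂(X, e, C)`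
[cite: GriffithsHarrisPrinciples1978, Ch. 3 §3 (Gauss–Bonnet formula) and Ch. 1 §1 (adjunction formula)].
Its discharge needs Chern classes of the tangent bundle of `Y(ℂ)` with the Gauss–Bonnet theorem on
the tree's carriers `complexBetti` (cf. the named fact
`Literature.AlgebraicTopology.CharacteristicClasses.chernClassTheory_nonempty`, on which the last
prover seat parked this fact); nothing of BFNP's paper is involved.

## References

* [BrosnanFangNiePearlstein2009] P. Brosnan, H. Fang, Z. Nie, G. Pearlstein, Singularities of
  admissible normal functions, Invent. Math. 177 (2009) 599–629, §5 Prop. 43 and its proof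
  (arXiv:0711.0964, PDF p. 11).
* [GriffithsHarrisPrinciples1978] P. Griffiths, J. Harris, Principles of Algebraic Geometry (1978),
  Ch. 1 §1 (adjunction formula), Ch. 3 §3 (Gauss–Bonnet formula `χ(M) = ∫_M c_n`).
* [VoisinHodgeII2003] C. Voisin, Hodge Theory and Complex Algebraic Geometry II, §1.2.2
  Thm. 1.22–1.23.
-/

noncomputable section

open CategoryTheory AlgebraicGeometry
open Literature.AlgebraicGeometry.Motives

namespace Literature.AlgebraicGeometry.HodgeTheory

section HodgeTheory

/-- NAMED FACT (EG) — **the topological Euler characteristic of the smooth members of `|𝒪_X(d)|`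
tends to `-∞` with `d`.** For every smooth projective complex `2n`-fold `X` (`n ≥ 1`) with a
projective embedding `e : X ↪ ℙᴺ` and every `C`, there is `d₂` such that for all `d ≥ d₂` every
SMOOTH hypersurface section `Y = X ∩ V₊(F)` (`deg F = d`, the scheme `e.hypersurfaceSection F hF`,
smooth projective of dimension `2n - 1`) has
`χ_top(Y(ℂ)) = Σ_{k ≤ 4n-2} (-1)^k b_k(Y(ℂ)) ≤ -C` (complex Betti numbers). Classical:
Gauss–Bonnet–Chern and adjunction give `χ_top(Y(ℂ)) = Σ_{j<2n} (-1)^j d^{j+1} ⟨c_{2n-1-j}(T_X) H^{j+1}, [X]⟩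
= -deg_e(X) d^{2n} + O(d^{2n-1})`. This is the hypothesis `hχ` of
`BFNP2009_vanishingCohomology_nontrivial.of_eulerChar` verbatim — the growth behind BFNP's "we can
make `dim H^{2n-1}(𝒳_η)` tend to infinity". Users take `(h : hypersurfaceSection_eulerChar_decay)`.
[cite: GriffithsHarrisPrinciples1978, Ch. 3 §3 (Gauss–Bonnet formula) and Ch. 1 §1 (adjunction formula)]
[cite: BrosnanFangNiePearlstein2009, §5 Prop. 43 (proof)] -/
def hypersurfaceSection_eulerChar_decay : Prop :=
  ∀ ⦃n : ℕ⦄ ⦃X : SchemeOver ℂ⦄, 0 < n → IsSmoothProjective (2 * n) X →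
    ∀ (e : ProjectiveEmbedding X) (C : ℕ), ∃ d₂ : ℕ, ∀ ⦃d : ℕ⦄, d₂ ≤ d →
      ∀ (F : MvPolynomial (Fin (e.n + 1)) ℂ) (hF : F.IsHomogeneous d),
        IsSmoothProjective (2 * n - 1) (e.hypersurfaceSection F hF) →
          ∑ k ∈ Finset.range (2 * (2 * n - 1) + 1),
              (-1 : ℤ) ^ k * (Module.finrank ℂ (complexBetti (e.hypersurfaceSection F hF) k) : ℤ)
            ≤ -(C : ℤ)

/-- **Assembly (fact-decompose): BFNP 2009, Prop. 43 from (EG).** The named fact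
`BFNP2009_vanishingCohomology_nontrivial` follows from `hypersurfaceSection_eulerChar_decay` — by
`BFNP2009_vanishingCohomology_nontrivial.of_eulerChar` (weak Lefschetz via Andreotti–Frankel and the
Betti-number bookkeeping, all proved in the tree). [cite: BrosnanFangNiePearlstein2009, §5 Prop. 43 (proof)] -/
theorem BFNP2009_vanishingCohomology_nontrivial_holds_of (h : hypersurfaceSection_eulerChar_decay) :
    BFNP2009_vanishingCohomology_nontrivial :=
  BFNP2009_vanishingCohomology_nontrivial.of_eulerChar h

end HodgeTheory

end Literature.AlgebraicGeometry.HodgeTheory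

end
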